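import Summits.QuantumFields.GaugeBoot.TiltedLatticeGauge
import HarnessLib

/-!
# Weighted Haar averages of a matrix representation: the scalar `c_w` of a class weight (gauge-boot, L3 negative supplement; twisted-slab mechanism 1/4)

HONEST FRAMING (cell `pub-gaugeboot`, page 1 of every file): the venture produces certified bounds
on lattice expectations at stated coupling, gauge group, dimension and torus size; NOT a mass gap,
NOT a continuum limit, NOT a string tension; NOT Yang–Mills-summit-bearing (barriers
`FixedCouplingUltralocality`, `PerturbativeInvisibility`). This module is group-theoretic
bookkeeping for a NEGATIVE result (`TiltedBoxOddAxisRPNegative.lean`): in-plane axis reflection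
positivity fails on the square 45°-tilted box of ODD side in `d ≥ 3`.

For a compact group `G` with normalised Haar measure `dk`, a continuous matrix representation
`ρ : G →* Matrix (Fin N) (Fin N) ℂ` and a continuous real CLASS weight `w` (`w(gkg⁻¹) = w(k)`):

* `wAvg ρ w = ∫ w(k) ρ(k) dk` (entrywise) commutes with every `ρ(g)` (`mul_wAvg_comm`); hence it is
  a scalar `c • 1` as soon as `ρ` has scalar commutant (`HasScalarCommutant ρ`, the conclusion of
  Schur's lemma for an irreducible `ρ`; kept as an explicit hypothesis, discharged for concrete
  groups elsewhere): `exists_wAvg_eq_smul`;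
* for the Wilson weight `w_β(k) = exp(β Re tr ρ(k))`: it is a class weight invariant under
  `k ↦ k⁻¹`, the trace of `wAvg ρ w_β` is the REAL number `∫ w_β Re χ_ρ` (`trace_wAvg_wilsonWeight`),
  and **`integral_wilsonWeight_mul_re_trace_pos`**: `0 < ∫ exp(β Re χ_ρ) Re χ_ρ dk` for `β > 0`,
  `N ≥ 1` — from `∫ Re χ_ρ dk = tr P ≥ 0` for the Hermitian idempotent `P = ∫ σ(k) dk` of the
  unitarised representation `σ` (`integral_re_trace_nonneg`) and `(e^{βu} - 1) u ≥ 0` with strict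
  inequality near `k = 1`. So the scalar `c_β` of `wAvg ρ w_β` is real and `> 0`
  (`wAvg_wilsonWeight_eq_smul_pos`);
* the one-variable entry identities used downstream: `∫ w(k) ρ(k)_{ab} dk = c δ_{ab}` and
  `∫ w(k) ρ(k⁻¹)_{ab} dk = c δ_{ab}` (`integral_weight_mul_entry(_inv)`).

Everything is `[folklore]` (Bröcker–tom Dieck II §4; Peter–Weyl is NOT used).

References: T. Bröcker, T. tom Dieck, Representations of Compact Lie Groups, GTM 98 (1985), II (4.1)–(4.2);
K. Osterwalder, E. Seiler, Ann. Phys. 110 (1978) 440, §2.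
-/

noncomputable section

open MeasureTheory Complex
open scoped Matrix ComplexConjugate
open Literature.MathematicalPhysics.QuantumFieldTheory (haarProbability)
open Literature.RepresentationTheory.CompactGroups

namespace Summit.QuantumFields.GaugeBoot

namespace TwistedSlab

variable {G : Type*} [Group G] [TopologicalSpace G] [IsTopologicalGroup G] [CompactSpace G]
  [MeasurableSpace G] [BorelSpace G] {N : ℕ} (ρ : G →* Matrix (Fin N) (Fin N) ℂ)

/-! ## Haar bookkeeping -/

/-- The normalised Haar measure is a probability measure. [folklore] -/
instance isProbabilityMeasure_haarProbability : IsProbabilityMeasure (haarProbability G) :=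
  CompactGroup.isProbabilityMeasure_haarMeasure_top

/-- The normalised Haar measure is a Haar measure. [folklore] -/
instance isHaarMeasure_haarProbability : (haarProbability G).IsHaarMeasure := by
  unfold haarProbability; infer_instance

/-- The normalised Haar measure is right invariant (compact groups are unimodular). [folklore] -/
instance isMulRightInvariant_haarProbability : (haarProbability G).IsMulRightInvariant :=
  CompactGroup.isMulRightInvariant_of_isHaarMeasure _

/-- The normalised Haar measure is inversion invariant. [folklore] -/
instance isInvInvariant_haarProbability : (haarProbability G).IsInvInvariant :=
  CompactGroup.isInvInvariant_of_isHaarMeasure _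

/-- Conjugation invariance of Haar integrals: `∫ f(g⁻¹ k g) dk = ∫ f dk`. [folklore] -/
theorem integral_conj_eq_self {E : Type*} [NormedAddCommGroup E] [NormedSpace ℝ E] (f : G → E) (g : G) :
    ∫ k, f (g⁻¹ * k * g) ∂(haarProbability G) = ∫ k, f k ∂(haarProbability G) := by
  have h1 := integral_mul_right_eq_self (μ := haarProbability G) (fun k => f (g⁻¹ * k)) g
  rw [show (fun k => f (g⁻¹ * k * g)) = fun k => f (g⁻¹ * (k * g)) from funext fun k => by
    rw [mul_assoc]]
  rw [h1]
  exact integral_mul_left_eq_self f g⁻¹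

/-! ## The weighted average of `ρ` -/

/-- **The weighted Haar average** `∫ w(k) ρ(k) dk` of the representation (entrywise Bochner
integrals). [folklore] -/
def wAvg (w : G → ℝ) : Matrix (Fin N) (Fin N) ℂ :=
  Matrix.of fun a b => ∫ k, (w k : ℂ) * ρ k a b ∂(haarProbability G)

/-- Entries of the weighted average. [folklore] -/
theorem wAvg_apply (w : G → ℝ) (a b : Fin N) :
    wAvg ρ w a b = ∫ k, (w k : ℂ) * ρ k a b ∂(haarProbability G) := rfl

omit [IsTopologicalGroup G] [CompactSpace G] [MeasurableSpace G] [BorelSpace G] in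
/-- The weighted entries are continuous. [folklore] -/
theorem continuous_weight_mul_entry {w : G → ℝ} (hw : Continuous w) (hρ : Continuous ρ) (a b : Fin N) :
    Continuous fun k => (w k : ℂ) * ρ k a b :=
  (continuous_ofReal.comp hw).mul (CompactGroup.continuous_entry hρ a b)

/-- **A class weight gives an average in the commutant**: `ρ(g) · wAvg = wAvg · ρ(g)`.
[folklore] -/
theorem mul_wAvg_comm {w : G → ℝ} (hw : Continuous w) (hcl : ∀ g k, w (g * k * g⁻¹) = w k)
    (hρ : Continuous ρ) (g : G) : ρ g * wAvg ρ w = wAvg ρ w * ρ g := by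
  ext a b
  have hint : ∀ c e, Integrable (fun k => (w k : ℂ) * ρ k c e) (haarProbability G) :=
    fun c e => (continuous_weight_mul_entry ρ hw hρ c e).integrable_of_hasCompactSupport (HasCompactSupport.of_compactSpace _)
  -- left side: `∫ w(k) (ρ g ρ k)_{ab}`; right side: `∫ w(k) (ρ k ρ g)_{ab}`
  have hL : (ρ g * wAvg ρ w) a b = ∫ k, (w k : ℂ) * ρ (g * k) a b ∂(haarProbability G) := by
    calc (ρ g * wAvg ρ w) a b = ∑ c, ρ g a c * ∫ k, (w k : ℂ) * ρ k c b ∂(haarProbability G) := by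
          simp only [Matrix.mul_apply, wAvg_apply]
      _ = ∫ k, ∑ c, ρ g a c * ((w k : ℂ) * ρ k c b) ∂(haarProbability G) := by
          rw [integral_finsetSum _ fun c _ => (hint c b).const_mul _]
          exact Finset.sum_congr rfl fun c _ => (integral_const_mul _ _).symm
      _ = ∫ k, (w k : ℂ) * ρ (g * k) a b ∂(haarProbability G) := by
          refine integral_congr_ae (ae_of_all _ fun k => ?_)
          simp only [map_mul, Matrix.mul_apply, Finset.mul_sum]
          exact Finset.sum_congr rfl fun c _ => by ring
  have hR : (wAvg ρ w * ρ g) a b = ∫ k, (w k : ℂ) * ρ (k * g) a b ∂(haarProbability G) := by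
    calc (wAvg ρ w * ρ g) a b = ∑ c, (∫ k, (w k : ℂ) * ρ k a c ∂(haarProbability G)) * ρ g c b := by
          simp only [Matrix.mul_apply, wAvg_apply]
      _ = ∫ k, ∑ c, (w k : ℂ) * ρ k a c * ρ g c b ∂(haarProbability G) := by
          rw [integral_finsetSum _ fun c _ => (hint a c).mul_const _]
          exact Finset.sum_congr rfl fun c _ => (integral_mul_const _ _).symm
      _ = ∫ k, (w k : ℂ) * ρ (k * g) a b ∂(haarProbability G) := by
          refine integral_congr_ae (ae_of_all _ fun k => ?_)
          simp only [map_mul, Matrix.mul_apply, Finset.mul_sum]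
          exact Finset.sum_congr rfl fun c _ => by ring
  rw [hL, hR, ← integral_conj_eq_self (fun k => (w k : ℂ) * ρ (g * k) a b) g]
  refine integral_congr_ae (ae_of_all _ fun k => ?_)
  show (w (g⁻¹ * k * g) : ℂ) * ρ (g * (g⁻¹ * k * g)) a b = (w k : ℂ) * ρ (k * g) a b
  have h1 : g * (g⁻¹ * k * g) = k * g := by group
  have h2 : w (g⁻¹ * k * g) = w k := by
    have := hcl g⁻¹ k
    rwa [inv_inv] at this
  rw [h1, h2]

/-- **Scalar commutant** (the conclusion of Schur's lemma for an irreducible `ρ`): every matrix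
commuting with all `ρ(g)` is a scalar. Kept as an explicit hypothesis of the negative results;
it holds for the defining representations of `SU(N)` (`N ≥ 2`) and `U(N)`. [folklore] -/
def HasScalarCommutant : Prop :=
  ∀ M : Matrix (Fin N) (Fin N) ℂ, (∀ g, ρ g * M = M * ρ g) → ∃ c : ℂ, M = c • (1 : Matrix (Fin N) (Fin N) ℂ)

/-- For `ρ` with scalar commutant the weighted average of a class weight is a scalar. [folklore] -/
theorem exists_wAvg_eq_smul (hirr : HasScalarCommutant ρ) {w : G → ℝ} (hw : Continuous w)
    (hcl : ∀ g k, w (g * k * g⁻¹) = w k) (hρ : Continuous ρ) :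
    ∃ c : ℂ, wAvg ρ w = c • (1 : Matrix (Fin N) (Fin N) ℂ) :=
  hirr _ fun g => mul_wAvg_comm ρ hw hcl hρ g

/-- **One-variable entry identity**: `∫ w(k) ρ(k)_{ab} dk = c δ_{ab}` when `wAvg ρ w = c • 1`.
[folklore] -/
theorem integral_weight_mul_entry {w : G → ℝ} {c : ℂ} (hc : wAvg ρ w = c • (1 : Matrix (Fin N) (Fin N) ℂ))
    (a b : Fin N) :
    ∫ k, (w k : ℂ) * ρ k a b ∂(haarProbability G) = if a = b then c else 0 := by
  rw [← wAvg_apply, hc, Matrix.smul_apply, Matrix.one_apply, smul_eq_mul, mul_ite, mul_one, mul_zero]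

/-- The same with `ρ(k⁻¹)`, for an inversion-invariant weight. [folklore] -/
theorem integral_weight_mul_entry_inv {w : G → ℝ} {c : ℂ} (hc : wAvg ρ w = c • (1 : Matrix (Fin N) (Fin N) ℂ))
    (hinv : ∀ k, w k⁻¹ = w k) (a b : Fin N) :
    ∫ k, (w k : ℂ) * ρ k⁻¹ a b ∂(haarProbability G) = if a = b then c else 0 := by
  rw [← integral_weight_mul_entry ρ hc a b,
    ← integral_inv_eq_self (fun k : G => (w k : ℂ) * ρ k a b) (haarProbability G)]
  exact integral_congr_ae (ae_of_all _ fun k => by simp only [hinv])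

/-! ## The Wilson weight `exp(β Re tr ρ)` -/

/-- The one-link Wilson weight `w_β(k) = exp(β Re tr ρ(k))`. [folklore] -/
def wilsonWeight (β : ℝ) (k : G) : ℝ := Real.exp (β * ((ρ k).trace).re)

omit [IsTopologicalGroup G] [CompactSpace G] [MeasurableSpace G] [BorelSpace G] in
/-- The Wilson weight is continuous. [folklore] -/
theorem continuous_wilsonWeight (hρ : Continuous ρ) (β : ℝ) : Continuous (wilsonWeight ρ β) :=
  Real.continuous_exp.comp (continuous_const.mul (Complex.continuous_re.comp hρ.matrix_trace))

omit [TopologicalSpace G] [IsTopologicalGroup G] [CompactSpace G] [MeasurableSpace G] [BorelSpace G] in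
/-- The Wilson weight is a class weight. [folklore] -/
theorem wilsonWeight_conj (β : ℝ) (g k : G) : wilsonWeight ρ β (g * k * g⁻¹) = wilsonWeight ρ β k := by
  rw [wilsonWeight, wilsonWeight, CompactGroup.trace_conj_eq]

omit [MeasurableSpace G] [BorelSpace G] in
/-- The Wilson weight is inversion invariant. [folklore] -/
theorem wilsonWeight_inv (hρ : Continuous ρ) (β : ℝ) (k : G) : wilsonWeight ρ β k⁻¹ = wilsonWeight ρ β k := by
  rw [wilsonWeight, wilsonWeight, CompactGroup.re_trace_map_inv ρ hρ]

omit [TopologicalSpace G] [IsTopologicalGroup G] [CompactSpace G] [MeasurableSpace G] [BorelSpace G] in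
/-- The Wilson weight is positive. [folklore] -/
theorem wilsonWeight_pos (β : ℝ) (k : G) : 0 < wilsonWeight ρ β k := Real.exp_pos _

/-! ### `∫ Re χ ≥ 0`: the Haar average of a unitary representation is a Hermitian idempotent -/

/-- The Haar average `P = ∫ σ(k) dk` of the unitarised representation (entrywise). [folklore] -/
def haarAvg (hρ : Continuous ρ) : Matrix (Fin N) (Fin N) ℂ :=
  Matrix.of fun a b => ∫ k, CompactGroup.unitarize ρ hρ k a b ∂(haarProbability G)

/-- `P` is idempotent: `P P = P` (left invariance of Haar measure). [folklore] -/
theorem haarAvg_mul_haarAvg (hρ : Continuous ρ) : haarAvg ρ hρ * haarAvg ρ hρ = haarAvg ρ hρ := by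
  set σ := CompactGroup.unitarize ρ hρ with hσ
  have hσc : Continuous σ := CompactGroup.continuous_unitarize ρ hρ
  have hint : ∀ a b, Integrable (fun k => σ k a b) (haarProbability G) :=
    fun a b => (CompactGroup.continuous_entry hσc a b).integrable_of_hasCompactSupport (HasCompactSupport.of_compactSpace _)
  ext a b
  simp only [Matrix.mul_apply, haarAvg, Matrix.of_apply]
  calc ∑ c, (∫ k, σ k a c ∂(haarProbability G)) * ∫ h, σ h c b ∂(haarProbability G)
      = ∫ k, ∑ c, σ k a c * ∫ h, σ h c b ∂(haarProbability G) ∂(haarProbability G) := by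
        rw [integral_finsetSum _ fun c _ => (hint a c).mul_const _]
        exact Finset.sum_congr rfl fun c _ => (integral_mul_const _ _).symm
    _ = ∫ k, ∫ h, σ (k * h) a b ∂(haarProbability G) ∂(haarProbability G) := by
        refine integral_congr_ae (ae_of_all _ fun k => ?_)
        simp only [map_mul, Matrix.mul_apply]
        rw [integral_finsetSum _ fun c _ => (hint c b).const_mul _]
        exact Finset.sum_congr rfl fun c _ => (integral_const_mul _ _).symm
    _ = ∫ k, ∫ h, σ h a b ∂(haarProbability G) ∂(haarProbability G) := by
        refine integral_congr_ae (ae_of_all _ fun k => ?_)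
        exact integral_mul_left_eq_self (fun h => σ h a b) k
    _ = ∫ h, σ h a b ∂(haarProbability G) := by
        rw [integral_const]; simp

/-- `P` is Hermitian (unitarity of `σ` and inversion invariance of Haar measure). [folklore] -/
theorem haarAvg_conjTranspose (hρ : Continuous ρ) : (haarAvg ρ hρ)ᴴ = haarAvg ρ hρ := by
  set σ := CompactGroup.unitarize ρ hρ with hσ
  ext a b
  simp only [Matrix.conjTranspose_apply, haarAvg, Matrix.of_apply, Complex.star_def, ← integral_conj]
  rw [← integral_inv_eq_self (fun k : G => σ k a b) (haarProbability G)]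
  refine integral_congr_ae (ae_of_all _ fun k => ?_)
  show (starRingEnd ℂ) (σ k b a) = σ k⁻¹ a b
  rw [hσ, CompactGroup.unitarize_inv ρ hρ k, Matrix.star_apply, Complex.star_def]

/-- **`∫ Re tr ρ(k) dk ≥ 0`**: it is the trace of the Hermitian idempotent `P`, i.e.
`∑_{a,b} |P_{ab}|²`. [folklore] -/
theorem integral_re_trace_nonneg (hρ : Continuous ρ) :
    0 ≤ ∫ k, ((ρ k).trace).re ∂(haarProbability G) := by
  set σ := CompactGroup.unitarize ρ hρ with hσ
  have hσc : Continuous σ := CompactGroup.continuous_unitarize ρ hρ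
  have hint : ∀ a b, Integrable (fun k => σ k a b) (haarProbability G) :=
    fun a b => (CompactGroup.continuous_entry hσc a b).integrable_of_hasCompactSupport (HasCompactSupport.of_compactSpace _)
  -- `∫ Re tr ρ = Re tr P`
  have h1 : ∫ k, ((ρ k).trace).re ∂(haarProbability G) = ((haarAvg ρ hρ).trace).re := by
    have h2 : ∫ k, ((ρ k).trace).re ∂(haarProbability G) =
        (∫ k, (σ k).trace ∂(haarProbability G)).re := by
      have h := integral_re (μ := haarProbability G)
        (hσc.matrix_trace.integrable_of_hasCompactSupport (HasCompactSupport.of_compactSpace _))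
      simp only [RCLike.re_to_complex] at h
      rw [← h]
      exact integral_congr_ae (ae_of_all _ fun k => by
        simp only [hσ, CompactGroup.trace_unitarize ρ hρ])
    rw [h2]
    congr 1
    simp only [Matrix.trace, Matrix.diag_apply, haarAvg, Matrix.of_apply]
    exact integral_finsetSum _ fun a _ => hint a a
  have h3 : (haarAvg ρ hρ).trace = ((haarAvg ρ hρ) * (haarAvg ρ hρ)ᴴ).trace := by
    rw [haarAvg_conjTranspose, haarAvg_mul_haarAvg]
  rw [h1, h3, Matrix.trace]
  simp only [Matrix.diag_apply, Matrix.mul_apply, Matrix.conjTranspose_apply, Complex.re_sum]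
  exact Finset.sum_nonneg fun a _ => Finset.sum_nonneg fun b _ => by
    simp only [Complex.star_def, Complex.mul_conj, Complex.ofReal_re]
    exact Complex.normSq_nonneg _

/-! ### Positivity of the scalar `c_β` -/

/-- **`0 < ∫ exp(β Re χ_ρ) Re χ_ρ dk` for `β > 0`, `N ≥ 1`**: split `e^{βu} u = u + (e^{βu} - 1) u`;
the first integral is `≥ 0` (`integral_re_trace_nonneg`), the second integrand is `≥ 0` everywhere
and `> 0` near `k = 1` (where `u = N`). [folklore] -/
theorem integral_wilsonWeight_mul_re_trace_pos (hρ : Continuous ρ) {β : ℝ} (hβ : 0 < β) (hN : 1 ≤ N) :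
    0 < ∫ k, wilsonWeight ρ β k * ((ρ k).trace).re ∂(haarProbability G) := by
  have huc : Continuous fun k => ((ρ k).trace).re := Complex.continuous_re.comp hρ.matrix_trace
  have hwc := continuous_wilsonWeight ρ hρ β
  have hsplit : ∀ k, wilsonWeight ρ β k * ((ρ k).trace).re =
      ((ρ k).trace).re + (wilsonWeight ρ β k - 1) * ((ρ k).trace).re := fun k => by ring
  have hI1 : Integrable (fun k => ((ρ k).trace).re) (haarProbability G) := huc.integrable_of_hasCompactSupport (HasCompactSupport.of_compactSpace _)
  have hc2 : Continuous fun k => (wilsonWeight ρ β k - 1) * ((ρ k).trace).re :=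
    (hwc.sub continuous_const).mul huc
  have hI2 : Integrable (fun k => (wilsonWeight ρ β k - 1) * ((ρ k).trace).re) (haarProbability G) :=
    hc2.integrable_of_hasCompactSupport (HasCompactSupport.of_compactSpace _)
  simp_rw [hsplit]
  rw [integral_add hI1 hI2]
  refine add_pos_of_nonneg_of_pos (integral_re_trace_nonneg ρ hρ) ?_
  -- the second integrand is nonnegative and positive on a neighbourhood of `1`
  have hnn : ∀ k, 0 ≤ (wilsonWeight ρ β k - 1) * ((ρ k).trace).re := by
    intro k
    by_cases hk : 0 ≤ ((ρ k).trace).re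
    · exact mul_nonneg (sub_nonneg.2 (Real.one_le_exp_iff.2 (mul_nonneg hβ.le hk))) hk
    · push Not at hk
      exact mul_nonneg_of_nonpos_of_nonpos
        (sub_nonpos.2 (Real.exp_le_one_iff.2 (mul_nonpos_of_nonneg_of_nonpos hβ.le hk.le))) hk.le
  rw [integral_pos_iff_support_of_nonneg (fun k => hnn k) hI2]
  -- the support contains the open set `{u > 0}`, which contains `1`
  have hopen : IsOpen {k : G | 0 < ((ρ k).trace).re} := isOpen_lt continuous_const huc
  have h1 : (1 : G) ∈ {k : G | 0 < ((ρ k).trace).re} := by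
    show 0 < ((ρ 1).trace).re
    simp only [map_one, Matrix.trace_one, Fintype.card_fin, Complex.natCast_re]
    exact_mod_cast hN
  refine lt_of_lt_of_le (hopen.measure_pos (haarProbability G) ⟨1, h1⟩) (measure_mono fun k hk => ?_)
  rw [Function.mem_support]
  have hk' : 0 < ((ρ k).trace).re := hk
  exact (mul_pos (sub_pos.2 (Real.one_lt_exp_iff.2 (mul_pos hβ hk'))) hk').ne'

/-- **The trace of the Wilson-weighted average is the real number `∫ w_β Re χ_ρ`.** [folklore] -/
theorem trace_wAvg_wilsonWeight (hρ : Continuous ρ) (β : ℝ) :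
    (wAvg ρ (wilsonWeight ρ β)).trace =
      ((∫ k, wilsonWeight ρ β k * ((ρ k).trace).re ∂(haarProbability G) : ℝ) : ℂ) := by
  have hwc := continuous_wilsonWeight ρ hρ β
  have hint : ∀ a b, Integrable (fun k => (wilsonWeight ρ β k : ℂ) * ρ k a b) (haarProbability G) :=
    fun a b => (continuous_weight_mul_entry ρ hwc hρ a b).integrable_of_hasCompactSupport (HasCompactSupport.of_compactSpace _)
  have hI : Integrable (fun k => (wilsonWeight ρ β k : ℂ) * (ρ k).trace) (haarProbability G) :=
    ((continuous_ofReal.comp hwc).mul hρ.matrix_trace).integrable_of_hasCompactSupport (HasCompactSupport.of_compactSpace _)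
  -- `tr wAvg = ∫ w tr ρ =: z`
  have h1 : (wAvg ρ (wilsonWeight ρ β)).trace =
      ∫ k, (wilsonWeight ρ β k : ℂ) * (ρ k).trace ∂(haarProbability G) := by
    simp only [Matrix.trace, Matrix.diag_apply, wAvg_apply]
    rw [← integral_finsetSum _ fun a _ => hint a a]
    exact integral_congr_ae (ae_of_all _ fun k => by simp only [Finset.mul_sum])
  set z := ∫ k, (wilsonWeight ρ β k : ℂ) * (ρ k).trace ∂(haarProbability G) with hz
  -- `z` is real: `conj z = z` by inversion invariance (`tr ρ(k⁻¹) = conj tr ρ(k)`)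
  have hconj : conj z = z := by
    rw [hz, ← integral_conj, ← integral_inv_eq_self
      (fun k : G => (wilsonWeight ρ β k : ℂ) * (ρ k).trace) (haarProbability G)]
    refine integral_congr_ae (ae_of_all _ fun k => ?_)
    show conj ((wilsonWeight ρ β k : ℂ) * (ρ k).trace) = (wilsonWeight ρ β k⁻¹ : ℂ) * (ρ k⁻¹).trace
    rw [map_mul, Complex.conj_ofReal, wilsonWeight_inv ρ hρ, CompactGroup.trace_map_inv ρ hρ]
  -- its real part is `∫ w Re tr ρ`
  have hre : z.re = ∫ k, wilsonWeight ρ β k * ((ρ k).trace).re ∂(haarProbability G) := by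
    have h := integral_re hI
    simp only [RCLike.re_to_complex] at h
    rw [hz, ← h]
    refine integral_congr_ae (ae_of_all _ fun k => ?_)
    simp only [Complex.mul_re, Complex.ofReal_re, Complex.ofReal_im, zero_mul, sub_zero]
  rw [h1, ← hre]
  exact (Complex.conj_eq_iff_re.1 hconj).symm

/-- **The scalar of the Wilson-weighted average is real and positive**: if `ρ` has scalar
commutant, `N ≥ 1` and `β > 0`, then `wAvg ρ w_β = c • 1` with `c = (∫ w_β Re χ_ρ) / N > 0`.
[folklore] -/
theorem wAvg_wilsonWeight_eq_smul_pos (hirr : HasScalarCommutant ρ) (hρ : Continuous ρ) {β : ℝ}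
    (hβ : 0 < β) (hN : 1 ≤ N) :
    ∃ c : ℝ, 0 < c ∧ wAvg ρ (wilsonWeight ρ β) = ((c : ℂ)) • (1 : Matrix (Fin N) (Fin N) ℂ) := by
  obtain ⟨c, hc⟩ := exists_wAvg_eq_smul ρ hirr (continuous_wilsonWeight ρ hρ β)
    (wilsonWeight_conj ρ β) hρ
  have htr := trace_wAvg_wilsonWeight ρ hρ β
  rw [hc, Matrix.trace_smul, Matrix.trace_one, Fintype.card_fin, smul_eq_mul] at htr
  have hNc : (N : ℂ) ≠ 0 := by exact_mod_cast (show N ≠ 0 by omega)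
  have hc' : c = ((∫ k, wilsonWeight ρ β k * ((ρ k).trace).re ∂(haarProbability G)) / N : ℝ) := by
    rw [Complex.ofReal_div, Complex.ofReal_natCast, ← htr, mul_div_cancel_right₀ _ hNc]
  have hNpos : (0 : ℝ) < N := by have : 0 < N := by omega
                                 exact_mod_cast this
  refine ⟨_, div_pos (integral_wilsonWeight_mul_re_trace_pos ρ hρ hβ hN) hNpos, ?_⟩
  rw [hc, hc']

end TwistedSlab

end Summit.QuantumFields.GaugeBoot

end
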